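import Summits.ResolutionOfSingularities.ResolutionOfSingularities.Theorems.DeltaCutRef
import HarnessLib

/-!
# DeltaCutRef2 — decomp-res node «RefCut» (lens-6 g27, critic row 204 CLEARED (F-curve WHOLE) DECIDED +1 · MAP 0),
tree file 2/5 of the node

Content VERBATIM from the decomp-res lens-6 g27 node `HOME/decomp-res-lens-6/g27/RefCut.lean` (pin df7099b8; no
carry, imports the landed `DeltaCutSepCells` + Literature; namespace `…Theorems.DeltaCutClasses`); HOME =
run/shared/lean/pub/decomp-res; critic CRITIC-LEDGER row 204 CLEARED (F-curve WHOLE) DECIDED +1 · MAP 0; landing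
orders NEXT-g28.md §4 + INBOX :1315 (09:51:49Z) — provenance, critic text and the lens header in full in the first
file of the node, `DeltaCutRef`.  `--kind proof --supports stmt-ResolutionOfSingularities-26971`.

## This file

Continuation 2/4 of `DeltaCutRef` (same namespace / sections of the node, cut at the tree's 400-line cap; section
variables / opens replayed): scopes `RefDefs`, `RefLaw`, `RefSing` — carries `RefStage.exit`, `RefStage.sep`,
`refHop`, `refRun`, `refRun_zero`, `refRun_succ`, `refRunHom`, `refRun_succ_front`, `RefStage.ofStage`,
`refHop_eq_exit`, `refHop_eq_resolve`, `refHop_eq_resolve_badClosure`, `refHop_eq_sep`, `RefStage.eq_ofStage`,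
`RefStage.eq_of_pending`, `RefMoves`, `RefTerminates`, `RefFrozen`, `RefPerpetual`, `not_refMoves_of_badEmpty`,
`not_refMoves_of_surface`, `not_refMoves_iff`, `refMoves_of_curveFrozen`, `refMoves_of_pending`,
`refMoves_of_sepActive`, `RefTerminates.not_refPerpetual`, `RefFrozen.not_refPerpetual`,
`RefTerminates.not_refFrozen`, `ref_trichotomy`, `not_refTerminates_iff`, `refRun_eq_of_not_moves`,
`refRun_eq_sepRun_of_active`, `SepTerminates.refTerminates`, `SepPerpetual.refPerpetual`,
`SepFrozen.refMoves_of_dimLEOne`, `SepFrozen.refFrozen_of_not_dimLEOne`, `singLocusOf_subset`,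
`mem_singLocusOf_iff`, `reducedRegular_iff_singLocusOf_eq_empty`.

[WRITER NOTE (decomp-res writer g13): file split only (tree files ≤ 400 lines; the plan's section groups, cut
further by the cap at declaration boundaries); namespace, sections, section `open`s / `variable`s and every
declaration exactly as in the lens (the node's HOME-only dupNamespace-linter line is dropped — the library sets it;
`noncomputable section`, the two file-level `open` lines, `universe u` and the namespace-level `open
…TwistCutClasses` / `open …LightCutClasses` of the node are replayed in every file).]

(Sources: Hironaka1964; Kollar2007 Thm. 1.101; Lipman1978 §1; CossartJannsenSaito2020 §5–§6, Def. 3.13 / Thm. 3.14;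
CossartPiltant2019 Prop. 2.6; EGAIV2 §7.8; BierstoneGrigorievMilmanWlodarczyk2011 §3; Hironaka1967; Giraud1975.)
-/

noncomputable section

open CategoryTheory CategoryTheory.Limits AlgebraicGeometry TopologicalSpace IsLocalRing
open Literature.AlgebraicGeometry.Resolution

universe u

namespace Summit.ResolutionOfSingularities.ResolutionOfSingularities.Theorems.DeltaCutClasses

open Summit.ResolutionOfSingularities.ResolutionOfSingularities.Theorems.TwistCutClasses
open Summit.ResolutionOfSingularities.ResolutionOfSingularities.Theorems.LightCutClasses

section RefDefs

open Summit.ResolutionOfSingularities.ResolutionOfSingularities.Theorems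
open WeakOrderReduction ForcedTowerClasses SubfieldContactClasses AbsoluteContactClasses PurityValveClasses
open Scheme.IdealSheafData (vanishingIdeal)

/-- the EXIT hop of a refined stage at a (regular) pending `S`: blow up `𝓘(S)` itself, controlled transform, pending := none.
DEFINITION (support). -/
def RefStage.exit (n : ℕ) (R : RefStage) (S : Closeds R.base.Y) : RefHop R :=
  { next := ⟨⟨blowup (vanishingIdeal S), controlledTransform (blowup.π (vanishingIdeal S)) (vanishingIdeal S) R.base.I n⟩, none⟩,
    hom := blowup.π (vanishingIdeal S) }

/-- the SEPARATING hop of a refined stage with no pending phase: g26's `sepHop` VERBATIM on the base, pending := none.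
DEFINITION (support). -/
def RefStage.sep (n : ℕ) (R : RefStage) : RefHop R :=
  { next := ⟨(sepHop n R.base).next, none⟩, hom := (sepHop n R.base).hom }

open Classical in
/-- **THE REFINED SEPARATING HOP** (canonical, choice-free, WITH MEMORY): if a pending old closure `S` is carried — EXIT
(blow up `𝓘(S)`, forget it) when `S_red` is regular, else RESOLVE (blow up the closure of `Sing S_red`, remember the strict
transform of `S`); if nothing is pending — at a level g26-FROZEN AT A CURVE start resolving the bad closure, otherwise do
g26's separating hop verbatim (active ⇒ step 1 (+ step 2); inactive ⇒ stay). DEFINITION (the step of the refined run). -/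
def refHop (n : ℕ) (R : RefStage) : RefHop R :=
  match R.pending with
  | some S => if ReducedRegular S then R.exit n S else R.resolve n S
  | none => if CurveFrozen n R.base then R.resolve n (badClosure n R.base) else R.sep n

/-- **THE REFINED SEPARATING RUN** `refRun n R : ℕ → RefStage` — iterate the refined hop (`Nat.rec`, END-iteration, as g25's
`run` and g26's `sepRun`). DEFINITION (the object). -/
def refRun (n : ℕ) (R : RefStage) : ℕ → RefStage := fun i => Nat.rec R (fun _ P => (refHop n P).next) i

/-- level `0` of the refined run is the refined stage itself. [folklore] -/
@[simp] theorem refRun_zero (n : ℕ) (R : RefStage) : refRun n R 0 = R := rfl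

/-- level `i+1` of the refined run is the refined hop of level `i`. [folklore] -/
theorem refRun_succ (n : ℕ) (R : RefStage) (i : ℕ) : refRun n R (i + 1) = (refHop n (refRun n R i)).next := rfl

/-- **THE HOP MORPHISMS OF THE REFINED RUN**. DEFINITION (support). -/
def refRunHom (n : ℕ) (R : RefStage) (i : ℕ) : (refRun n R (i + 1)).base.Y ⟶ (refRun n R i).base.Y :=
  (refHop n (refRun n R i)).hom

/-- the refined run of the next refined stage is the tail of the refined run. [folklore] -/
theorem refRun_succ_front (n : ℕ) (R : RefStage) : ∀ i : ℕ, refRun n R (i + 1) = refRun n (refHop n R).next i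
  | 0 => rfl
  | i + 1 => by
    show (refHop n (refRun n R (i + 1))).next = (refHop n (refRun n (refHop n R).next i)).next
    rw [refRun_succ_front n R i]

/-- the datum's refined stage: the g25 stage with NO pending phase. DEFINITION (support). -/
abbrev RefStage.ofStage (N : Stage) : RefStage := ⟨N, none⟩

open Classical in
/-- computation rule: pending `S` with `S_red` REGULAR ⇒ the refined hop is the EXIT hop. [folklore] -/
theorem refHop_eq_exit {n : ℕ} {N : Stage} {S : Closeds N.Y} (hr : ReducedRegular S) :
    refHop n ⟨N, some S⟩ = RefStage.exit n ⟨N, some S⟩ S := by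
  show (if ReducedRegular S then _ else _) = _
  rw [if_pos hr]

open Classical in
/-- computation rule: pending `S` with `S_red` IRREGULAR ⇒ the refined hop is the RESOLVE hop at `S`. [folklore] -/
theorem refHop_eq_resolve {n : ℕ} {N : Stage} {S : Closeds N.Y} (hr : ¬ ReducedRegular S) :
    refHop n ⟨N, some S⟩ = RefStage.resolve n ⟨N, some S⟩ S := by
  show (if ReducedRegular S then _ else _) = _
  rw [if_neg hr]

open Classical in
/-- computation rule: nothing pending at a level FROZEN AT A CURVE ⇒ the refined hop is the RESOLVE hop at the bad closure.
[folklore] -/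
theorem refHop_eq_resolve_badClosure {n : ℕ} {N : Stage} (hc : CurveFrozen n N) :
    refHop n ⟨N, none⟩ = RefStage.resolve n ⟨N, none⟩ (badClosure n N) := by
  show (if CurveFrozen n N then _ else _) = _
  rw [if_pos hc]

open Classical in
/-- computation rule: nothing pending, not frozen at a curve ⇒ the refined hop is g26's separating hop. [folklore] -/
theorem refHop_eq_sep {n : ℕ} {N : Stage} (hc : ¬ CurveFrozen n N) : refHop n ⟨N, none⟩ = RefStage.sep n ⟨N, none⟩ := by
  show (if CurveFrozen n N then _ else _) = _
  rw [if_neg hc]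

/-- a refined stage with no pending phase IS the refined stage of its base. [folklore] -/
theorem RefStage.eq_ofStage {R : RefStage} (h : R.pending = none) : R = ⟨R.base, none⟩ := by
  obtain ⟨N, P⟩ := R
  cases P with
  | none => rfl
  | some S' => exact absurd h (Option.some_ne_none S')

/-- a refined stage with pending `S` IS `⟨base, some S⟩`. [folklore] -/
theorem RefStage.eq_of_pending {R : RefStage} {S : Closeds R.base.Y} (h : R.pending = some S) : R = ⟨R.base, some S⟩ := by
  obtain ⟨N, P⟩ := R
  cases P with
  | none => exact absurd h.symm (Option.some_ne_none S)
  | some S' =>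
    have hS : S' = S := Option.some.inj h
    subst hS; rfl

end RefDefs

section RefLaw

open Summit.ResolutionOfSingularities.ResolutionOfSingularities.Theorems
open WeakOrderReduction ForcedTowerClasses SubfieldContactClasses AbsoluteContactClasses PurityValveClasses

/-! ### §RefLaw — the LETTERS of the refined run, their TRICHOTOMY, and the SUB-KIND THEOREM (construction half) -/

/-- `RefMoves n R` — the refined hop MOVES at `R`: a pending phase is running, or the level is g26-active, or it is frozen at a
curve (the three cases in which `refHop` blows something up). DEFINITION (letter). -/
def RefMoves (n : ℕ) (R : RefStage) : Prop := R.pending.isSome ∨ SepActive n R.base ∨ CurveFrozen n R.base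

/-- **`RefTerminates n R`** — the refined run TERMINATES: a moving prefix, then a level with no pending phase and EMPTY bad
locus. DEFINITION (letter; the DECIDED kind). -/
def RefTerminates (n : ℕ) (R : RefStage) : Prop :=
  ∃ h : ℕ, (∀ j < h, RefMoves n (refRun n R j)) ∧ (refRun n R h).pending = none ∧ BadEmpty n (refRun n R h).base

/-- **`RefFrozen n R`** — the refined run FREEZES: a moving prefix, then a level with no pending phase, NONEMPTY bad locus,
IRREGULAR reduced closure of dimension NOT `≤ 1` (kind F-surface; NO inhabitant known). DEFINITION (letter; RESIDUAL). -/
def RefFrozen (n : ℕ) (R : RefStage) : Prop :=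
  ∃ h : ℕ, (∀ j < h, RefMoves n (refRun n R j)) ∧ (refRun n R h).pending = none ∧ ¬ BadEmpty n (refRun n R h).base ∧
    ¬ ClosureRegular n (refRun n R h).base ∧ ¬ DimLEOne (badClosure n (refRun n R h).base)

/-- **`RefPerpetual n R`** — the refined run is PERPETUAL: every level moves (kind P′; NO inhabitant known). DEFINITION
(letter; RESIDUAL). -/
def RefPerpetual (n : ℕ) (R : RefStage) : Prop := ∀ i : ℕ, RefMoves n (refRun n R i)

/-- a level with no pending phase and empty bad locus does not move. [new] [folklore] -/
theorem not_refMoves_of_badEmpty {n : ℕ} {R : RefStage} (hP : R.pending = none) (he : BadEmpty n R.base) : ¬ RefMoves n R := by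
  rintro (h | h | h)
  · rw [hP] at h; exact Bool.false_ne_true h
  · exact h.1 he
  · exact h.1 he

/-- a level with no pending phase frozen at a NON-curve does not move. [new] [folklore] -/
theorem not_refMoves_of_surface {n : ℕ} {R : RefStage} (hP : R.pending = none) (hirr : ¬ ClosureRegular n R.base)
    (hdim : ¬ DimLEOne (badClosure n R.base)) : ¬ RefMoves n R := by
  rintro (h | h | h)
  · rw [hP] at h; exact Bool.false_ne_true h
  · exact hirr h.2
  · exact hdim h.2.2

/-- **THE NON-MOVING LEVELS READ EXACTLY**: the refined hop does not move iff nothing is pending and the level is either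
bad-empty or frozen at an irregular closure of dimension NOT `≤ 1`. [new] [folklore] -/
theorem not_refMoves_iff {n : ℕ} {R : RefStage} : ¬ RefMoves n R ↔ R.pending = none ∧
    (BadEmpty n R.base ∨ (¬ BadEmpty n R.base ∧ ¬ ClosureRegular n R.base ∧ ¬ DimLEOne (badClosure n R.base))) := by
  constructor
  · intro h
    have hP : R.pending = none := by
      cases hR : R.pending with
      | none => rfl
      | some S => exact absurd (Or.inl (by rw [hR]; rfl)) h
    refine ⟨hP, ?_⟩
    by_cases he : BadEmpty n R.base
    · exact Or.inl he
    · have hirr : ¬ ClosureRegular n R.base := fun hr => h (Or.inr (Or.inl ⟨he, hr⟩))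
      exact Or.inr ⟨he, hirr, fun hd => h (Or.inr (Or.inr ⟨he, hirr, hd⟩))⟩
  · rintro ⟨hP, he | ⟨_, hirr, hdim⟩⟩
    · exact not_refMoves_of_badEmpty hP he
    · exact not_refMoves_of_surface hP hirr hdim

/-- **THE SUB-KIND THEOREM, construction half · NO LEVEL OF THE REFINED RUN FREEZES AT A BAD CLOSURE OF DIMENSION `≤ 1`**:
a level with nothing pending, nonempty bad locus and IRREGULAR reduced closure of dimension `≤ 1` — g26's frozen kind
F-curve — MOVES (the refined hop starts resolving the closure). [new] [folklore] -/
theorem refMoves_of_curveFrozen {n : ℕ} {R : RefStage} (hc : CurveFrozen n R.base) : RefMoves n R := Or.inr (Or.inr hc)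

/-- … and a level inside a pending phase MOVES. [new] [folklore] -/
theorem refMoves_of_pending {n : ℕ} {R : RefStage} {S : Closeds R.base.Y} (h : R.pending = some S) : RefMoves n R :=
  Or.inl (by rw [h]; rfl)

/-- … and a g26-active level MOVES. [new] [folklore] -/
theorem refMoves_of_sepActive {n : ℕ} {R : RefStage} (h : SepActive n R.base) : RefMoves n R := Or.inr (Or.inl h)

/-- exclusivity: a terminating refined run is not perpetual. [new] [folklore] -/
theorem RefTerminates.not_refPerpetual {n : ℕ} {R : RefStage} (h : RefTerminates n R) : ¬ RefPerpetual n R :=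
  fun hP => by obtain ⟨i, _, hP0, he⟩ := h; exact not_refMoves_of_badEmpty hP0 he (hP i)

/-- exclusivity: a frozen refined run is not perpetual. [new] [folklore] -/
theorem RefFrozen.not_refPerpetual {n : ℕ} {R : RefStage} (h : RefFrozen n R) : ¬ RefPerpetual n R :=
  fun hP => by obtain ⟨i, _, hP0, _, hirr, hdim⟩ := h; exact not_refMoves_of_surface hP0 hirr hdim (hP i)

/-- exclusivity: a terminating refined run is not frozen (the first non-moving level is unique). [new] [folklore] -/
theorem RefTerminates.not_refFrozen {n : ℕ} {R : RefStage} (h : RefTerminates n R) : ¬ RefFrozen n R := by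
  rintro ⟨i', hpre', hP', hne', hirr', hdim'⟩
  obtain ⟨i, hpre, hP0, he⟩ := h
  rcases lt_trichotomy i i' with hlt | rfl | hgt
  · exact not_refMoves_of_badEmpty hP0 he (hpre' i hlt)
  · exact hne' he
  · exact not_refMoves_of_surface hP' hirr' hdim' (hpre i' hgt)

/-- **TRICHOTOMY OF THE REFINED RUN** (hypothesis-free): it terminates, or freezes (at a NON-curve), or is perpetual — the
first non-moving level, if any, exists by `Nat.find` and is read by `not_refMoves_iff`. [new] [folklore] -/
theorem ref_trichotomy (n : ℕ) (R : RefStage) : RefTerminates n R ∨ RefFrozen n R ∨ RefPerpetual n R := by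
  classical
  by_cases hP : RefPerpetual n R
  · exact Or.inr (Or.inr hP)
  · have hex : ∃ i : ℕ, ¬ RefMoves n (refRun n R i) := not_forall.mp hP
    have hh : ¬ RefMoves n (refRun n R (Nat.find hex)) := Nat.find_spec hex
    have hpre : ∀ j < Nat.find hex, RefMoves n (refRun n R j) := fun j hj => not_not.mp (Nat.find_min hex hj)
    obtain ⟨hP0, he | ⟨hne, hirr, hdim⟩⟩ := not_refMoves_iff.mp hh
    · exact Or.inl ⟨Nat.find hex, hpre, hP0, he⟩
    · exact Or.inr (Or.inl ⟨Nat.find hex, hpre, hP0, hne, hirr, hdim⟩)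

/-- **THE RESIDUAL LETTER READ EXACTLY**: `¬ RefTerminates ⟺ RefFrozen ∨ RefPerpetual` (hypothesis-free). [new] [folklore] -/
theorem not_refTerminates_iff (n : ℕ) (R : RefStage) : ¬ RefTerminates n R ↔ RefFrozen n R ∨ RefPerpetual n R := by
  constructor
  · intro h
    rcases ref_trichotomy n R with ht | hf | hp
    · exact absurd ht h
    · exact Or.inl hf
    · exact Or.inr hp
  · rintro (hf | hp) ht
    · exact ht.not_refFrozen hf
    · exact ht.not_refPerpetual hp

/-- **A NON-MOVING LEVEL IS FINAL**: from the first non-moving level on, the refined run STAYS. [new] [folklore] -/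
theorem refRun_eq_of_not_moves {n : ℕ} {R : RefStage} {h : ℕ} (hh : ¬ RefMoves n (refRun n R h)) :
    ∀ i : ℕ, h ≤ i → refRun n R i = refRun n R h := by
  have hstep : ∀ Q : RefStage, ¬ RefMoves n Q → (refHop n Q).next = Q := by
    intro Q hQ
    obtain ⟨hP, hcase⟩ := not_refMoves_iff.mp hQ
    have hc : ¬ CurveFrozen n Q.base := fun hc => hQ (refMoves_of_curveFrozen hc)
    have ha : ¬ SepActive n Q.base := fun ha => hQ (refMoves_of_sepActive ha)
    rw [RefStage.eq_ofStage hP, refHop_eq_sep hc]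
    show (⟨(sepHop n Q.base).next, none⟩ : RefStage) = ⟨Q.base, none⟩
    rw [sepHop_next_of_not_active ha]
  intro i hi
  obtain ⟨d, rfl⟩ := Nat.exists_eq_add_of_le hi
  induction d with
  | zero => rfl
  | succ d ih => rw [← Nat.add_assoc, refRun_succ, ih (Nat.le_add_right h d), hstep _ hh]

/-! #### The refined run EXTENDS the separating run: on an active separating prefix the two coincide -/

/-- on a g26-ACTIVE prefix the refined run IS the separating run (no pending phase is ever started). [new] [folklore] -/
theorem refRun_eq_sepRun_of_active {n : ℕ} (N : Stage) {h : ℕ} (hpre : ∀ j < h, SepActive n (sepRun n N j)) :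
    ∀ i ≤ h, refRun n ⟨N, none⟩ i = ⟨sepRun n N i, none⟩ := by
  intro i
  induction i with
  | zero => intro _; rfl
  | succ i ih =>
    intro hi
    have hact : SepActive n (sepRun n N i) := hpre i (Nat.lt_of_succ_le hi)
    have hc : ¬ CurveFrozen n (sepRun n N i) := fun hc => hc.2.1 hact.2
    rw [refRun_succ, ih (Nat.le_of_succ_le hi), refHop_eq_sep hc]
    rfl

/-- **g26's DECIDED CELL SITS INSIDE THE REFINED DECIDED CELL**: a terminating separating run is a terminating refined run
(same height). [new] [folklore] -/
theorem SepTerminates.refTerminates {n : ℕ} {N : Stage} (h : SepTerminates n N) : RefTerminates n ⟨N, none⟩ := by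
  obtain ⟨h, hpre, he⟩ := h
  refine ⟨h, fun j hj => ?_, ?_, ?_⟩
  · rw [refRun_eq_sepRun_of_active N hpre j hj.le]; exact refMoves_of_sepActive (hpre j hj)
  · rw [refRun_eq_sepRun_of_active N hpre h le_rfl]
  · rw [refRun_eq_sepRun_of_active N hpre h le_rfl]; exact he

/-- a perpetual separating run is a perpetual refined run. [new] [folklore] -/
theorem SepPerpetual.refPerpetual {n : ℕ} {N : Stage} (h : SepPerpetual n N) : RefPerpetual n ⟨N, none⟩ := fun i => by
  rw [refRun_eq_sepRun_of_active N (h := i) (fun j _ => h j) i le_rfl]; exact refMoves_of_sepActive (h i)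

/-- **THE SUB-KIND F-curve IS GONE**: a separating run FROZEN AT A CURVE (g26's letter F with a closure of dimension `≤ 1` at
the frozen level — C×) is a refined run that MOVES at that level. [new] [folklore] -/
theorem SepFrozen.refMoves_of_dimLEOne {n : ℕ} {N : Stage} {h : ℕ} (hpre : ∀ j < h, SepActive n (sepRun n N j))
    (hne : ¬ BadEmpty n (sepRun n N h)) (hirr : ¬ ClosureRegular n (sepRun n N h)) (hdim : DimLEOne (badClosure n (sepRun n N h))) :
    RefMoves n (refRun n ⟨N, none⟩ h) := by
  rw [refRun_eq_sepRun_of_active N hpre h le_rfl]; exact refMoves_of_curveFrozen ⟨hne, hirr, hdim⟩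

/-- a separating run frozen at a NON-curve is a frozen refined run (kind F-surface is what remains of kind F). [new]
[folklore] -/
theorem SepFrozen.refFrozen_of_not_dimLEOne {n : ℕ} {N : Stage} {h : ℕ} (hpre : ∀ j < h, SepActive n (sepRun n N j))
    (hne : ¬ BadEmpty n (sepRun n N h)) (hirr : ¬ ClosureRegular n (sepRun n N h))
    (hdim : ¬ DimLEOne (badClosure n (sepRun n N h))) : RefFrozen n ⟨N, none⟩ := by
  refine ⟨h, fun j hj => ?_, ?_, ?_, ?_, ?_⟩
  · rw [refRun_eq_sepRun_of_active N hpre j hj.le]; exact refMoves_of_sepActive (hpre j hj)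
  all_goals rw [refRun_eq_sepRun_of_active N hpre h le_rfl]
  exacts [hne, hirr, hdim]

end RefLaw

section RefSing

open Summit.ResolutionOfSingularities.ResolutionOfSingularities.Theorems
open WeakOrderReduction ForcedTowerClasses SubfieldContactClasses AbsoluteContactClasses PurityValveClasses
open Scheme.IdealSheafData (vanishingIdeal)

/-! ### §RefSing — (S) THE SINGULAR LOCUS OF A REDUCED CURVE ON A BASE SCHEME IS A FINITE SET OF CLOSED POINTS
(tree currency: J-2 openness `Scheme.isOpen_regularLocus_of_isQuasiExcellent` + `Stacks07QW_field_holds`, generic points of a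
reduced scheme are regular `isField_stalk_of_closure_mem_irreducibleComponents`, dimension drop
`Literature.Topology.topologicalKrullDim_lt_of_forall_exists_specializes`, `Set.finite_of_topologicalKrullDim_le_zero`) -/

/-- the singular locus of `S_red` lies on `S`. [folklore] -/
theorem singLocusOf_subset {Y : Scheme.{0}} (S : Closeds Y) : singLocusOf S ⊆ (S : Set Y) := by
  rintro _ ⟨c, -, rfl⟩
  have h : (vanishingIdeal S).subschemeι.base c ∈ Set.range (vanishingIdeal S).subschemeι.base := ⟨c, rfl⟩
  rwa [range_subschemeι_vanishingIdeal] at h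

/-- a point of `S_red` maps into the singular locus iff it is a non-regular point. [folklore] -/
theorem mem_singLocusOf_iff {Y : Scheme.{0}} (S : Closeds Y) (c : (vanishingIdeal S).subscheme) :
    (vanishingIdeal S).subschemeι.base c ∈ singLocusOf S ↔ c ∉ Scheme.regularLocus (vanishingIdeal S).subscheme := by
  constructor
  · rintro ⟨c', hc', he⟩
    rwa [← (vanishingIdeal S).subschemeι.isClosedEmbedding.injective he]
  · exact fun h => ⟨c, h, rfl⟩

/-- `S_red` is regular iff its singular locus is empty. [folklore] -/
theorem reducedRegular_iff_singLocusOf_eq_empty {Y : Scheme.{0}} (S : Closeds Y) :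
    ReducedRegular S ↔ singLocusOf S = ∅ := by
  constructor
  · intro h
    ext y
    simp only [Set.mem_empty_iff_false, iff_false]
    rintro ⟨c, hc, rfl⟩
    exact hc (h c)
  · intro h c
    by_contra hc
    have : (vanishingIdeal S).subschemeι.base c ∈ singLocusOf S := ⟨c, hc, rfl⟩
    rw [h] at this
    exact this

end RefSing

end Summit.ResolutionOfSingularities.ResolutionOfSingularities.Theorems.DeltaCutClasses
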